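import Mathlib
import HarnessLib

/-!
# The greedy smooth/rough factorisation `n = d m` (proof of Prop. 4.2, p. 15)

Trunk AntSieve, tooling toward the named fact `Literature.NumberTheory.Sieve.weakDHL_three_two_of_GEH`
(D. H. J. Polymath, Res. Math. Sci. 1:12 (2014) = arXiv:1407.4897, Theorem 3.2(xii)), here the
combinatorial device in the proof of Proposition 4.2 (almost primality), p. 15: "we factorize
`n + h_j = p_1 ⋯ p_r` in increasing order, and then write `n + h_j = d_j m_j` where
`d_j := p_1 ⋯ p_{i_j}` and `i_j` is the largest index for which `p_1 ⋯ p_{i_j} < x^{1/10k}`, and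
`m_j := p_{i_j+1} ⋯ p_r`. By construction `d_j ≤ x^{1/10k}`,
`p_{i_j+1} ≥ (p_1 ⋯ p_{i_j+1})^{1/(i_j+1)} ≥ x^{1/(10k(i_j+1))}`, `r = O(i_j + 1)` …".

For a threshold `y > 1` and `m ≥ 1` with sorted prime factor list `L`:
* `spIndex y m` — the largest `i` with `∏ (L.take i) < y`; `smoothPart y m = ∏ (L.take i)`,
  `roughPart y m = ∏ (L.drop i)`;
* `smoothPart_mul_roughPart`, `smoothPart_lt`, `cardFactors_smoothPart`,
  `le_of_mem_primeFactorsList_roughPart` (every prime factor `p` of the rough part has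
  `y ≤ p^{Ω(d)+1}`), `cardFactors_roughPart_mul_log_le` (`Ω(m') log y ≤ (Ω(d)+1) log m`),
  `exists_prime_dvd_smoothPart_of_dvd` (a prime factor `≤ z < y` of `m` forces a prime factor
  `≤ z` of `d`).

## References

* [Polymath8b2014] D. H. J. Polymath, Res. Math. Sci. 1 (2014), Art. 12 = arXiv:1407.4897,
  proof of Proposition 4.2, p. 15.
-/

noncomputable section

open scoped ArithmeticFunction.Omega ArithmeticFunction.omega

namespace Literature.NumberTheory.Sieve

namespace SmoothPart

/-! ### List preliminaries -/

/-- A list of naturals all `≤ n` has product `≤ n^{length}`. [folklore] -/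
theorem list_prod_le_pow {n : ℕ} : ∀ (l : List ℕ), (∀ x ∈ l, x ≤ n) → l.prod ≤ n ^ l.length
  | [], _ => by simp
  | a :: l, h => by
    rw [List.prod_cons, List.length_cons, pow_succ, mul_comm (n ^ l.length)]
    exact Nat.mul_le_mul (h a List.mem_cons_self) (list_prod_le_pow l fun x hx => h x (List.mem_cons_of_mem _ hx))

/-- A list of naturals all `≥ n` has product `≥ n^{length}`. [folklore] -/
theorem pow_le_list_prod {n : ℕ} : ∀ (l : List ℕ), (∀ x ∈ l, n ≤ x) → n ^ l.length ≤ l.prod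
  | [], _ => by simp
  | a :: l, h => by
    rw [List.prod_cons, List.length_cons, pow_succ, mul_comm (n ^ l.length)]
    exact Nat.mul_le_mul (h a List.mem_cons_self) (pow_le_list_prod l fun x hx => h x (List.mem_cons_of_mem _ hx))

/-- Products of lists of positive naturals are monotone along prefixes. [folklore] -/
theorem prod_take_le_prod {l : List ℕ} (hl : ∀ x ∈ l, 0 < x) (i : ℕ) : (l.take i).prod ≤ l.prod := by
  conv_rhs => rw [← List.take_append_drop i l]
  rw [List.prod_append]
  refine Nat.le_mul_of_pos_right _ (List.prod_pos fun x hx => hl x (List.mem_of_mem_drop hx))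

/-! ### The factorisation -/

/-- The number of prime factors (with multiplicity, in increasing order) put into the smooth part:
the largest `i` with `p_1 ⋯ p_i < y`. [cite: Polymath8b2014, proof of Prop. 4.2, p. 15] -/
def spIndex (y : ℝ) (m : ℕ) : ℕ :=
  Nat.findGreatest (fun i => (((m.primeFactorsList.take i).prod : ℕ) : ℝ) < y) m.primeFactorsList.length

/-- The smooth part `d = p_1 ⋯ p_i`. [cite: Polymath8b2014, proof of Prop. 4.2, p. 15] -/
def smoothPart (y : ℝ) (m : ℕ) : ℕ := (m.primeFactorsList.take (spIndex y m)).prod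

/-- The rough part `m' = p_{i+1} ⋯ p_r`. [cite: Polymath8b2014, proof of Prop. 4.2, p. 15] -/
def roughPart (y : ℝ) (m : ℕ) : ℕ := (m.primeFactorsList.drop (spIndex y m)).prod

/-- `i ≤ r`. [folklore] -/
theorem spIndex_le (y : ℝ) (m : ℕ) : spIndex y m ≤ m.primeFactorsList.length := Nat.findGreatest_le _

/-- `d · m' = m`. [folklore] -/
theorem smoothPart_mul_roughPart (y : ℝ) {m : ℕ} (hm : m ≠ 0) : smoothPart y m * roughPart y m = m := by
  rw [smoothPart, roughPart, List.prod_take_mul_prod_drop, Nat.prod_primeFactorsList hm]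

/-- `d ∣ m`. [folklore] -/
theorem smoothPart_dvd (y : ℝ) {m : ℕ} (hm : m ≠ 0) : smoothPart y m ∣ m :=
  Dvd.intro _ (smoothPart_mul_roughPart y hm)

/-- `m' ∣ m`. [folklore] -/
theorem roughPart_dvd (y : ℝ) {m : ℕ} (hm : m ≠ 0) : roughPart y m ∣ m :=
  Dvd.intro_left _ (smoothPart_mul_roughPart y hm)

/-- `0 < d`. [folklore] -/
theorem smoothPart_pos (y : ℝ) (m : ℕ) : 0 < smoothPart y m :=
  List.prod_pos fun _ hp => Nat.pos_of_mem_primeFactorsList (List.mem_of_mem_take hp)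

/-- `0 < m'`. [folklore] -/
theorem roughPart_pos (y : ℝ) (m : ℕ) : 0 < roughPart y m :=
  List.prod_pos fun _ hp => Nat.pos_of_mem_primeFactorsList (List.mem_of_mem_drop hp)

/-- `d < y` (for `y > 1`). [cite: Polymath8b2014, proof of Prop. 4.2, p. 15] -/
theorem smoothPart_lt {y : ℝ} (hy : 1 < y) (m : ℕ) : (smoothPart y m : ℝ) < y := by
  have h := Nat.findGreatest_spec (P := fun i => (((m.primeFactorsList.take i).prod : ℕ) : ℝ) < y)
    (Nat.zero_le m.primeFactorsList.length) (by simpa using hy)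
  exact h

/-- The prime factor lists of the two parts. [folklore] -/
theorem perm_primeFactorsList_smoothPart (y : ℝ) (m : ℕ) :
    (m.primeFactorsList.take (spIndex y m)).Perm (smoothPart y m).primeFactorsList :=
  Nat.primeFactorsList_unique rfl fun _ hp => Nat.prime_of_mem_primeFactorsList (List.mem_of_mem_take hp)

/-- The prime factor list of the rough part. [folklore] -/
theorem perm_primeFactorsList_roughPart (y : ℝ) (m : ℕ) :
    (m.primeFactorsList.drop (spIndex y m)).Perm (roughPart y m).primeFactorsList :=
  Nat.primeFactorsList_unique rfl fun _ hp => Nat.prime_of_mem_primeFactorsList (List.mem_of_mem_drop hp)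

/-- `Ω(d) = i`. [folklore] -/
theorem cardFactors_smoothPart (y : ℝ) (m : ℕ) : Ω (smoothPart y m) = spIndex y m := by
  rw [ArithmeticFunction.cardFactors_apply, ← (perm_primeFactorsList_smoothPart y m).length_eq, List.length_take,
    min_eq_left (spIndex_le y m)]

/-- `Ω(m') = r - i`. [folklore] -/
theorem cardFactors_roughPart (y : ℝ) (m : ℕ) : Ω (roughPart y m) = m.primeFactorsList.length - spIndex y m := by
  rw [ArithmeticFunction.cardFactors_apply, ← (perm_primeFactorsList_roughPart y m).length_eq, List.length_drop]

/-- `Ω(d) + Ω(m') = Ω(m)`. [folklore] -/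
theorem cardFactors_smoothPart_add (y : ℝ) (m : ℕ) : Ω (smoothPart y m) + Ω (roughPart y m) = Ω m := by
  rw [cardFactors_smoothPart, cardFactors_roughPart, ArithmeticFunction.cardFactors_apply,
    Nat.add_sub_cancel' (spIndex_le y m)]

/-- The prime factors of `m'` are among the last `r - i` prime factors of `m`. [folklore] -/
theorem mem_drop_of_mem_primeFactorsList_roughPart {y : ℝ} {m p : ℕ} (hp : p ∈ (roughPart y m).primeFactorsList) :
    p ∈ m.primeFactorsList.drop (spIndex y m) :=
  (perm_primeFactorsList_roughPart y m).symm.subset hp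

/-- **The rough part is rough**: if `i < r` then every prime factor `p` of `m'` satisfies
`y ≤ p_{i+1}^{i+1} ≤ p^{i+1}`; in all cases `y ≤ p^{Ω(d)+1}` for every prime factor `p` of `m'`
(when `i = r` there is none). [cite: Polymath8b2014, proof of Prop. 4.2, p. 15] -/
theorem le_pow_of_mem_primeFactorsList_roughPart {y : ℝ} {m p : ℕ} (hp : p ∈ (roughPart y m).primeFactorsList) :
    y ≤ (p : ℝ) ^ (Ω (smoothPart y m) + 1) := by
  set L := m.primeFactorsList with hL
  set i := spIndex y m with hi
  have hsorted : L.Pairwise (· ≤ ·) := List.sortedLE_iff_pairwise.1 (Nat.primeFactorsList_sorted m)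
  have hpd : p ∈ L.drop i := mem_drop_of_mem_primeFactorsList_roughPart hp
  -- hence `i < r`
  have hilt : i < L.length := by
    by_contra h
    push Not at h
    rw [List.drop_eq_nil_iff.2 h] at hpd
    exact (List.not_mem_nil hpd).elim
  -- `p' = L[i] ≤ p`
  have hp' : L[i] ≤ p := by
    rw [List.drop_eq_getElem_cons hilt, List.mem_cons] at hpd
    rcases hpd with rfl | h
    · exact le_rfl
    · exact hsorted.rel_of_mem_take_of_mem_drop (i := i + 1)
        (List.mem_take_iff_getElem.2 ⟨i, by simp [hilt], rfl⟩) h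
  -- `y ≤ ∏ (L.take (i+1)) ≤ p'^{i+1}`
  have hmax : ¬ ((((L.take (i + 1)).prod : ℕ) : ℝ) < y) :=
    Nat.findGreatest_is_greatest (P := fun i => (((L.take i).prod : ℕ) : ℝ) < y) (Nat.lt_succ_self _) hilt
  push Not at hmax
  have hprod : (L.take (i + 1)).prod ≤ L[i] ^ (i + 1) := by
    have hlen : (L.take (i + 1)).length = i + 1 := by rw [List.length_take, min_eq_left hilt]
    have h := list_prod_le_pow (n := L[i]) (L.take (i + 1)) fun x hx => by
      rw [List.take_succ_eq_append_getElem hilt, List.mem_append, List.mem_singleton] at hx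
      rcases hx with hx | rfl
      · exact hsorted.rel_of_mem_take_of_mem_drop hx (by rw [List.drop_eq_getElem_cons hilt]; exact List.mem_cons_self)
      · exact le_rfl
    rwa [hlen] at h
  rw [cardFactors_smoothPart]
  calc y ≤ (((L.take (i + 1)).prod : ℕ) : ℝ) := hmax
    _ ≤ ((L[i] ^ (i + 1) : ℕ) : ℝ) := by exact_mod_cast hprod
    _ ≤ (p : ℝ) ^ (i + 1) := by push_cast; exact pow_le_pow_left₀ (Nat.cast_nonneg _) (by exact_mod_cast hp') _

/-- **Few prime factors in the rough part**: `Ω(m') · log y ≤ (Ω(d) + 1) · log m` (`m ≥ 1`, `y > 1`).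
[cite: Polymath8b2014, proof of Prop. 4.2, p. 15] -/
theorem cardFactors_roughPart_mul_log_le {y : ℝ} (hy : 1 < y) {m : ℕ} (hm : m ≠ 0) :
    (Ω (roughPart y m) : ℝ) * Real.log y ≤ (Ω (smoothPart y m) + 1 : ℝ) * Real.log m := by
  set r := roughPart y m with hr
  have hr0 : 0 < r := roughPart_pos y m
  -- `p^{Ω(m')} ≤ m'` for the least prime factor `p` of `m'`, and `y ≤ p^{Ω(d)+1}`
  rcases (Ω r).eq_zero_or_pos with h0 | hpos
  · rw [h0, Nat.cast_zero, zero_mul]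
    exact mul_nonneg (by positivity) (Real.log_nonneg (by exact_mod_cast Nat.one_le_iff_ne_zero.2 hm))
  · have hne : r.primeFactorsList ≠ [] := by
      intro h; rw [ArithmeticFunction.cardFactors_apply, h, List.length_nil] at hpos; exact lt_irrefl _ hpos
    have hr1 : r ≠ 1 := by
      intro h; apply hne; rw [h]; exact Nat.primeFactorsList_one
    -- the least prime factor `p₀` of `r`
    set p₀ := r.minFac with hp₀def
    have hp₀prime : p₀.Prime := Nat.minFac_prime hr1
    have hp₀ : p₀ ∈ r.primeFactorsList := (Nat.mem_primeFactorsList_iff_dvd hr0.ne' hp₀prime).2 (Nat.minFac_dvd r)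
    have hmin : ∀ x ∈ r.primeFactorsList, p₀ ≤ x := fun x hx =>
      Nat.minFac_le_of_dvd (Nat.prime_of_mem_primeFactorsList hx).two_le (Nat.dvd_of_mem_primeFactorsList hx)
    have hp₀1 : (1 : ℝ) < p₀ := by exact_mod_cast hp₀prime.one_lt
    have hpow : p₀ ^ Ω r ≤ r := by
      rw [ArithmeticFunction.cardFactors_apply]
      have := pow_le_list_prod r.primeFactorsList fun x hx => hmin x hx
      rwa [Nat.prod_primeFactorsList hr0.ne'] at this
    have hy' : y ≤ (p₀ : ℝ) ^ (Ω (smoothPart y m) + 1) := le_pow_of_mem_primeFactorsList_roughPart hp₀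
    have hrm : (r : ℝ) ≤ m := by exact_mod_cast Nat.le_of_dvd (Nat.pos_of_ne_zero hm) (roughPart_dvd y hm)
    have h1 : (Ω r : ℝ) * Real.log p₀ ≤ Real.log m := by
      rw [← Real.log_pow]
      exact Real.log_le_log (by positivity) ((by exact_mod_cast hpow : ((p₀ : ℝ) ^ Ω r) ≤ r).trans hrm)
    have h2 : Real.log y ≤ (Ω (smoothPart y m) + 1 : ℝ) * Real.log p₀ := by
      rw [← Nat.cast_succ, ← Real.log_pow]
      exact Real.log_le_log (by linarith) hy'
    have hlogp₀ : 0 < Real.log p₀ := Real.log_pos hp₀1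
    calc (Ω r : ℝ) * Real.log y ≤ (Ω r : ℝ) * ((Ω (smoothPart y m) + 1 : ℝ) * Real.log p₀) :=
          mul_le_mul_of_nonneg_left h2 (Nat.cast_nonneg _)
      _ = (Ω (smoothPart y m) + 1 : ℝ) * ((Ω r : ℝ) * Real.log p₀) := by ring
      _ ≤ (Ω (smoothPart y m) + 1 : ℝ) * Real.log m := mul_le_mul_of_nonneg_left h1 (by positivity)

/-- **A small prime factor lives in the smooth part**: if a prime `p ≤ z` divides `m` and `z < y`,
then `d` has a prime factor `≤ z` (namely the least prime factor of `m`). [folklore] -/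
theorem exists_prime_dvd_smoothPart_of_dvd {y z : ℝ} (hzy : z < y) {m p : ℕ} (hm : m ≠ 0) (hp : p.Prime) (hpm : p ∣ m)
    (hpz : (p : ℝ) ≤ z) : ∃ q : ℕ, q.Prime ∧ q ∣ smoothPart y m ∧ (q : ℝ) ≤ z := by
  set L := m.primeFactorsList with hL
  have hpL : p ∈ L := (Nat.mem_primeFactorsList_iff_dvd hm hp).2 hpm
  have hlen : 0 < L.length := List.length_pos_of_mem hpL
  have hsorted : L.Pairwise (· ≤ ·) := List.sortedLE_iff_pairwise.1 (Nat.primeFactorsList_sorted m)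
  set q := L[0]'hlen with hq
  have hqL : q ∈ L.take 1 := List.mem_take_iff_getElem.2 ⟨0, by simp [hlen], rfl⟩
  have hqprime : q.Prime := Nat.prime_of_mem_primeFactorsList (List.mem_of_mem_take hqL)
  -- `q ≤ p`
  have hqp : q ≤ p := by
    have : p ∈ L.take 1 ++ L.drop 1 := by rwa [List.take_append_drop]
    rw [List.mem_append] at this
    rcases this with h | h
    · rw [List.take_succ_eq_append_getElem hlen, List.take_zero, List.nil_append, List.mem_singleton] at h
      exact h ▸ le_rfl
    · exact hsorted.rel_of_mem_take_of_mem_drop hqL h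
  -- hence `1 ≤ i`
  have htake1 : L.take 1 = [q] := by
    rw [List.take_succ_eq_append_getElem hlen, List.take_zero, List.nil_append]
  have hP1 : (((L.take 1).prod : ℕ) : ℝ) < y := by
    rw [htake1, List.prod_singleton]
    exact lt_of_le_of_lt ((Nat.cast_le.2 hqp).trans hpz) hzy
  have hi : 1 ≤ spIndex y m :=
    Nat.le_findGreatest (P := fun i => (((L.take i).prod : ℕ) : ℝ) < y) hlen hP1
  refine ⟨q, hqprime, ?_, (Nat.cast_le.2 hqp).trans hpz⟩
  rw [smoothPart]
  refine List.dvd_prod (List.mem_take_iff_getElem.2 ⟨0, ?_, rfl⟩)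
  simpa [List.length_take] using lt_min hi hlen

/-- `ω(m) ≤ ω(d) + ω(m')`. [folklore] -/
theorem cardDistinctFactors_le_add (y : ℝ) {m : ℕ} (hm : m ≠ 0) :
    ω m ≤ ω (smoothPart y m) + ω (roughPart y m) := by
  simp only [ArithmeticFunction.cardDistinctFactors_apply, ← List.card_toFinset, Nat.toFinset_factors]
  conv_lhs => rw [← smoothPart_mul_roughPart y hm]
  rw [Nat.primeFactors_mul (smoothPart_pos y m).ne' (roughPart_pos y m).ne']
  exact Finset.card_union_le _ _

/-- The prime factors of the smooth part are prime factors of `m`. [folklore] -/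
theorem primeFactors_smoothPart_subset (y : ℝ) {m : ℕ} (hm : m ≠ 0) : (smoothPart y m).primeFactors ⊆ m.primeFactors :=
  Nat.primeFactors_mono (smoothPart_dvd y hm) hm

/-- The prime factors of the rough part are prime factors of `m`. [folklore] -/
theorem primeFactors_roughPart_subset (y : ℝ) {m : ℕ} (hm : m ≠ 0) : (roughPart y m).primeFactors ⊆ m.primeFactors :=
  Nat.primeFactors_mono (roughPart_dvd y hm) hm

/-- Rough-part roughness, `primeFactors` form. [folklore] -/
theorem le_pow_of_mem_primeFactors_roughPart {y : ℝ} {m p : ℕ} (hp : p ∈ (roughPart y m).primeFactors) :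
    y ≤ (p : ℝ) ^ (Ω (smoothPart y m) + 1) :=
  le_pow_of_mem_primeFactorsList_roughPart (Nat.mem_primeFactors_iff_mem_primeFactorsList.1 hp)

end SmoothPart

end Literature.NumberTheory.Sieve
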